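import Summits.ValiantsHypothesis.ValiantsHypothesis.Theorems.LacunarySymmetroidMatrixDescartesCensusV19CSoundCerts

/-!
# `MatrixDescartes` census — soundness of the CASE-C checker: consequences of the order check `V19C.ordOK` (the `20` sums, the collided atoms `A, B`, the slots) and the coefficient dictionary

HONEST FRAMING.  Object-search cell `pub-symmetroid`; door-A item `DoorA26 = PosRootLawAt 2 6 19`
(stmt-ValiantsHypothesis-19979; OPEN, typed, never asserted).  Part of the proof that certificates accepted by `V19C.checkSupport` (`…CensusV19CCheck`)
exclude a nineteen on a one-collision support.  Concrete layer, first half: what the Boolean order check guarantees about the slot list of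
`V19C.mkCtx`, and the dictionary «coefficient at a pair sum = sum of the atoms with that pair sum» for ANY six-term `2 × 2` symmetric pencil.
Nothing here bears on the `2`-Sidon supports, on `ζ_sym(2,6)` over all supports, on `DoorA26` itself, on `MatrixDescartes`
(stmt-ValiantsHypothesis-18050) or on `VP ≠ VNP`.

[folklore] Certificate-checker soundness; elementary.
-/

-- the D-0017 layout repeats a namespace component (single-conjunct summit); the `dupNamespace` linter flags it; name mandated.
set_option linter.dupNamespace false

namespace Summit.ValiantsHypothesis.ValiantsHypothesis.Theorems.LacunarySymmetroidMatrixDescartes.Census.V19C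

open V20 (Atom allAtoms psum posOf qA cA Term PolySpec posl FNat fval Row FRat negAt tval pval lprod aval qv bv pdet dfun fin6
  posOf_lt_length getD_posOf mem_allAtoms_iff qA_mem cA_mem psum_cA fin6_eq aval_qA aval_cA)

section Order

open Polynomial Finset
open scoped BigOperators Polynomial Matrix

/-! ### `posOf` on concatenations -/

/-- `posOf` on a cons. [folklore] -/
theorem posOf_cons (a b : Atom) (l : List Atom) : posOf a (b :: l) = if b = a then 0 else posOf a l + 1 := rfl

/-- `posOf` of a member of the left part of a concatenation. [folklore] -/
theorem posOf_append_of_mem {a : Atom} : ∀ {L : List Atom} (M : List Atom), a ∈ L → posOf a (L ++ M) = posOf a L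
  | [], _, h => by simp at h
  | b :: L, M, h => by
    rw [List.cons_append, posOf_cons, posOf_cons]
    split_ifs with hb
    · rfl
    · have h' : a ∈ L := by
        rcases List.mem_cons.1 h with h | h
        · exact absurd h.symm hb
        · exact h
      rw [posOf_append_of_mem M h']

/-- `posOf` of a non-member of the left part of a concatenation. [folklore] -/
theorem posOf_append_of_not_mem {a : Atom} : ∀ {L : List Atom} (M : List Atom), a ∉ L → posOf a (L ++ M) = L.length + posOf a M
  | [], _, _ => by simp
  | b :: L, M, h => by
    rw [List.cons_append, posOf_cons, if_neg (fun e => h (by rw [e]; simp)),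
      posOf_append_of_not_mem M (fun h' => h (List.mem_cons_of_mem _ h')), List.length_cons]
    omega

variable {dl : List ℕ} {ord : List Atom} {pstar : ℕ}

/-! ### The order check, unpacked -/

/-- The checked order, unpacked. [folklore] -/
theorem ordOK_spec (h : ordOK dl ord pstar = true) :
    dl.length = 6 ∧ ord.length = 21 ∧ (∀ a ∈ allAtoms, a ∈ ord) ∧ (∀ b ∈ ord, b ∈ allAtoms) ∧ pstar + 1 < 21 ∧
      psum dl (ord.getD pstar (0, 0)) = psum dl (ord.getD (pstar + 1) (0, 0)) ∧
      (ord.eraseIdx (pstar + 1)).Pairwise (fun a b => psum dl a < psum dl b) := by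
  simpa [ordOK, Bool.and_eq_true, decide_eq_true_eq, and_assoc] using h

/-- The reduced order has `20` atoms. [folklore] -/
theorem length_o20 (h : ordOK dl ord pstar = true) : (ord.eraseIdx (pstar + 1)).length = 20 := by
  obtain ⟨-, hlen, -, -, hp, -⟩ := ordOK_spec h
  rw [List.length_eraseIdx]
  simp [hlen, hp]

/-- The `20` sums. [folklore] -/
theorem length_E (h : ordOK dl ord pstar = true) : ((ord.eraseIdx (pstar + 1)).map (psum dl)).length = 20 := by
  rw [List.length_map, length_o20 h]

/-- The `20` sums increase strictly. [folklore] -/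
theorem E_lt (h : ordOK dl ord pstar = true) {t u : ℕ} (htu : t < u) (hu : u < 20) :
    ((ord.eraseIdx (pstar + 1)).map (psum dl)).getD t 0 < ((ord.eraseIdx (pstar + 1)).map (psum dl)).getD u 0 := by
  have hpw := (ordOK_spec h).2.2.2.2.2.2
  have hpw' : ((ord.eraseIdx (pstar + 1)).map (psum dl)).Pairwise (· < ·) := by rw [List.pairwise_map]; exact hpw
  have hl := length_E h
  rw [List.getD_eq_getElem _ _ (by omega), List.getD_eq_getElem _ _ (by omega)]
  exact List.pairwise_iff_getElem.1 hpw' t u (by omega) (by omega) htu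

/-- The `20` sums are monotone. [folklore] -/
theorem E_le (h : ordOK dl ord pstar = true) {t u : ℕ} (htu : t ≤ u) (hu : u < 20) :
    ((ord.eraseIdx (pstar + 1)).map (psum dl)).getD t 0 ≤ ((ord.eraseIdx (pstar + 1)).map (psum dl)).getD u 0 := by
  rcases htu.eq_or_lt with rfl | hlt
  · exact le_rfl
  · exact (E_lt h hlt hu).le

/-- Positions with equal sums are equal. [folklore] -/
theorem E_inj (h : ordOK dl ord pstar = true) {t u : ℕ} (ht : t < 20) (hu : u < 20)
    (he : ((ord.eraseIdx (pstar + 1)).map (psum dl)).getD t 0 = ((ord.eraseIdx (pstar + 1)).map (psum dl)).getD u 0) : t = u := by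
  by_contra hne
  rcases Nat.lt_or_gt_of_ne hne with hlt | hlt
  · have := E_lt h hlt hu; omega
  · have := E_lt h hlt ht; omega

/-- The sum at position `t` is the pair sum of the `t`-th atom of the reduced order. [folklore] -/
theorem E_getD (h : ordOK dl ord pstar = true) {t : ℕ} (ht : t < 20) :
    ((ord.eraseIdx (pstar + 1)).map (psum dl)).getD t 0 = psum dl ((ord.eraseIdx (pstar + 1))[t]'(by rw [length_o20 h]; exact ht)) := by
  rw [List.getD_eq_getElem _ _ (by rw [length_E h]; exact ht), List.getElem_map]

/-- The `20` sums are pairwise distinct. [folklore] -/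
theorem E_nodup (h : ordOK dl ord pstar = true) : ((ord.eraseIdx (pstar + 1)).map (psum dl)).Nodup := by
  have hpw := (ordOK_spec h).2.2.2.2.2.2
  have hpw' : ((ord.eraseIdx (pstar + 1)).map (psum dl)).Pairwise (· < ·) := by rw [List.pairwise_map]; exact hpw
  exact hpw'.imp ne_of_lt

/-- The set of the `20` sums has `20` elements. [folklore] -/
theorem card_E (h : ordOK dl ord pstar = true) : ((ord.eraseIdx (pstar + 1)).map (psum dl)).toFinset.card = 20 := by
  rw [List.toFinset_card_of_nodup (E_nodup h), length_E h]

/-! ### The collided atoms `A = ord[p⋆]`, `B = ord[p⋆ + 1]` -/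

/-- `A` is the `p⋆`-th atom of the reduced order. [folklore] -/
theorem o20_getElem_pstar (h : ordOK dl ord pstar = true) :
    (ord.eraseIdx (pstar + 1))[pstar]'(by rw [length_o20 h]; have := (ordOK_spec h).2.2.2.2.1; omega) = ord.getD pstar (0, 0) := by
  obtain ⟨-, hlen, -, -, hp, -⟩ := ordOK_spec h
  rw [List.getElem_eraseIdx_of_lt (by rw [length_o20 h]; omega) (Nat.lt_succ_self pstar), List.getD_eq_getElem _ _ (by omega)]

/-- Every atom is `B` or a member of the reduced order. [folklore] -/
theorem mem_o20_or_eq_B (h : ordOK dl ord pstar = true) {a : Atom} (ha : a ∈ allAtoms) :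
    a ∈ ord.eraseIdx (pstar + 1) ∨ a = ord.getD (pstar + 1) (0, 0) := by
  obtain ⟨-, hlen, hall, -, hp, -⟩ := ordOK_spec h
  obtain ⟨i, hi, rfl⟩ := List.getElem_of_mem (hall a ha)
  by_cases hip : i = pstar + 1
  · right; subst hip; rw [List.getD_eq_getElem _ _ (by omega)]
  · left
    exact (List.mem_eraseIdx_iff_getElem).2 ⟨i, hi, hip, rfl⟩

/-- A member of the reduced order sits at a position `< 20` whose sum is its pair sum. [folklore] -/
theorem exists_pos_of_mem_o20 (h : ordOK dl ord pstar = true) {a : Atom} (ha : a ∈ ord.eraseIdx (pstar + 1)) :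
    ∃ t, ∃ ht : t < 20, (ord.eraseIdx (pstar + 1))[t]'(by rw [length_o20 h]; exact ht) = a := by
  obtain ⟨t, ht, rfl⟩ := List.getElem_of_mem ha
  exact ⟨t, by rw [length_o20 h] at ht; exact ht, rfl⟩

/-- `psum A` is the sum at position `p⋆`. [folklore] -/
theorem psum_A (h : ordOK dl ord pstar = true) :
    psum dl (ord.getD pstar (0, 0)) = ((ord.eraseIdx (pstar + 1)).map (psum dl)).getD pstar 0 := by
  have hp := (ordOK_spec h).2.2.2.2.1
  rw [E_getD h (by omega), o20_getElem_pstar h]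

/-- `psum B` is the sum at position `p⋆`. [folklore] -/
theorem psum_B (h : ordOK dl ord pstar = true) :
    psum dl (ord.getD (pstar + 1) (0, 0)) = ((ord.eraseIdx (pstar + 1)).map (psum dl)).getD pstar 0 := by
  rw [← (ordOK_spec h).2.2.2.2.2.1, psum_A h]

/-- An atom whose pair sum is the sum at position `t` is the `t`-th atom of the reduced order, or `B` (and then `t = p⋆`). [folklore] -/
theorem atom_of_psum_eq (h : ordOK dl ord pstar = true) {a : Atom} (ha : a ∈ allAtoms) {t : ℕ} (ht : t < 20)
    (he : psum dl a = ((ord.eraseIdx (pstar + 1)).map (psum dl)).getD t 0) :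
    a = (ord.eraseIdx (pstar + 1))[t]'(by rw [length_o20 h]; exact ht) ∨ (a = ord.getD (pstar + 1) (0, 0) ∧ t = pstar) := by
  rcases mem_o20_or_eq_B h ha with hm | hB
  · left
    obtain ⟨u, hu, rfl⟩ := exists_pos_of_mem_o20 h hm
    rw [← E_getD h hu] at he
    have := E_inj h hu ht he
    subst this; rfl
  · right
    refine ⟨hB, ?_⟩
    have hp := (ordOK_spec h).2.2.2.2.1
    rw [hB, psum_B h] at he
    exact (E_inj h (by omega) ht he).symm

/-- `A ≠ B`: the full order lists the `21` distinct atoms in `21` places, so it has no repetition. [folklore] -/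
theorem A_ne_B (h : ordOK dl ord pstar = true) : ord.getD pstar (0, 0) ≠ ord.getD (pstar + 1) (0, 0) := by
  obtain ⟨-, hlen, hall, -, hp, -⟩ := ordOK_spec h
  have hnd : ord.Nodup := by
    have hsub : allAtoms.toFinset ⊆ ord.toFinset := fun a ha => List.mem_toFinset.2 (hall a (List.mem_toFinset.1 ha))
    have hcard : 21 ≤ ord.toFinset.card := le_trans (by decide) (Finset.card_le_card hsub)
    rw [List.card_toFinset] at hcard
    have hsl := List.dedup_sublist ord
    have heq : ord.dedup.length = ord.length := le_antisymm hsl.length_le (by omega)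
    rw [← hsl.eq_of_length heq]
    exact List.nodup_dedup _
  rw [List.getD_eq_getElem _ _ (by omega), List.getD_eq_getElem _ _ (by omega)]
  intro heq
  have := (List.Nodup.getElem_inj_iff hnd).1 heq
  omega

/-- `A` is an atom. [folklore] -/
theorem A_mem (h : ordOK dl ord pstar = true) : ord.getD pstar (0, 0) ∈ allAtoms := by
  obtain ⟨-, hlen, -, hmem, hp, -⟩ := ordOK_spec h
  rw [List.getD_eq_getElem _ _ (by omega)]
  exact hmem _ (List.getElem_mem _)

/-- `B` is an atom. [folklore] -/
theorem B_mem (h : ordOK dl ord pstar = true) : ord.getD (pstar + 1) (0, 0) ∈ allAtoms := by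
  obtain ⟨-, hlen, -, hmem, hp, -⟩ := ordOK_spec h
  rw [List.getD_eq_getElem _ _ (by omega)]
  exact hmem _ (List.getElem_mem _)

/-- Entries of the reduced order are atoms. [folklore] -/
theorem o20_mem_allAtoms (h : ordOK dl ord pstar = true) {t : ℕ} (ht : t < 20) :
    (ord.eraseIdx (pstar + 1))[t]'(by rw [length_o20 h]; exact ht) ∈ allAtoms :=
  (ordOK_spec h).2.2.2.1 _ ((List.eraseIdx_sublist _ _).subset (List.getElem_mem _))

/-- `B` is not in the reduced order. [folklore] -/
theorem B_not_mem_o20 (h : ordOK dl ord pstar = true) : ord.getD (pstar + 1) (0, 0) ∉ ord.eraseIdx (pstar + 1) := by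
  intro hm
  obtain ⟨t, ht, het⟩ := exists_pos_of_mem_o20 h hm
  have he : psum dl (ord.getD (pstar + 1) (0, 0)) = ((ord.eraseIdx (pstar + 1)).map (psum dl)).getD t 0 := by
    rw [E_getD h ht, het]
  rw [psum_B h] at he
  have hp := (ordOK_spec h).2.2.2.2.1
  have := E_inj h (by omega) ht he
  subst this
  rw [o20_getElem_pstar h] at het
  exact A_ne_B h het

/-! ### Slots -/

variable {s : Bool} {br : Br}

/-- The slot list of `mkCtx`. [folklore] -/
theorem mkCtx_ordS : (mkCtx dl ord pstar s br).ordS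
    = (ord.eraseIdx (pstar + 1)).set pstar (6, 6) ++ [ord.getD pstar (0, 0), ord.getD (pstar + 1) (0, 0)] := rfl

/-- The sums of `mkCtx`. [folklore] -/
theorem mkCtx_E : (mkCtx dl ord pstar s br).E = (ord.eraseIdx (pstar + 1)).map (psum dl) := rfl

/-- `p⋆` of `mkCtx`. [folklore] -/
theorem mkCtx_pstar : (mkCtx dl ord pstar s br).pstar = pstar := rfl

/-- The slot of an atom of the reduced order at a position `t ≠ p⋆` is `t`. [folklore] -/
theorem slot_of_o20 (h : ordOK dl ord pstar = true) {t : ℕ} (ht : t < 20) (htp : t ≠ pstar) :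
    (mkCtx dl ord pstar s br).slot ((ord.eraseIdx (pstar + 1))[t]'(by rw [length_o20 h]; exact ht)) = t := by
  set a := (ord.eraseIdx (pstar + 1))[t]'(by rw [length_o20 h]; exact ht) with ha
  have hset : ((ord.eraseIdx (pstar + 1)).set pstar (6, 6))[t]'(by rw [List.length_set, length_o20 h]; exact ht) = a := by
    rw [List.getElem_set_ne (Ne.symm htp)]
  have hmem : a ∈ (ord.eraseIdx (pstar + 1)).set pstar (6, 6) := by rw [← hset]; exact List.getElem_mem _
  unfold Ctx.slot
  rw [mkCtx_ordS, posOf_append_of_mem _ hmem]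
  -- `posOf` is the first occurrence; all earlier entries differ from `a` (distinct sums, and the dummy is not an atom's position)
  have hlt := posOf_lt_length hmem
  have hget := getD_posOf (dflt := (0, 0)) hmem
  rw [List.getD_eq_getElem _ _ hlt] at hget
  set u := posOf a ((ord.eraseIdx (pstar + 1)).set pstar (6, 6)) with hu
  have hu20 : u < 20 := by rw [List.length_set, length_o20 h] at hlt; exact hlt
  by_cases hup : u = pstar
  · exfalso
    rw [List.getElem_set] at hget
    rw [if_pos hup.symm] at hget
    have ha6 : a ∈ allAtoms := o20_mem_allAtoms h ht
    rw [← hget] at ha6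
    exact absurd ha6 (by decide)
  · rw [List.getElem_set_ne (Ne.symm hup)] at hget
    have he : ((ord.eraseIdx (pstar + 1)).map (psum dl)).getD u 0 = ((ord.eraseIdx (pstar + 1)).map (psum dl)).getD t 0 := by
      rw [E_getD h hu20, E_getD h ht, hget]
    exact E_inj h hu20 ht he

/-- `A` is not in the dummied reduced order. [folklore] -/
theorem A_not_mem_set (h : ordOK dl ord pstar = true) : ord.getD pstar (0, 0) ∉ (ord.eraseIdx (pstar + 1)).set pstar (6, 6) := by
  intro hm
  obtain ⟨u, hu, hget⟩ := List.getElem_of_mem hm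
  have hu20 : u < 20 := by rw [List.length_set, length_o20 h] at hu; exact hu
  by_cases hup : u = pstar
  · subst hup
    rw [List.getElem_set_self] at hget
    exact absurd (hget ▸ A_mem h) (by decide)
  · rw [List.getElem_set_ne (Ne.symm hup)] at hget
    have he : ((ord.eraseIdx (pstar + 1)).map (psum dl)).getD u 0 = ((ord.eraseIdx (pstar + 1)).map (psum dl)).getD pstar 0 := by
      rw [E_getD h hu20, hget, psum_A h]
    have hp := (ordOK_spec h).2.2.2.2.1
    exact hup (E_inj h hu20 (by omega) he)

/-- `B` is not in the dummied reduced order. [folklore] -/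
theorem B_not_mem_set (h : ordOK dl ord pstar = true) :
    ord.getD (pstar + 1) (0, 0) ∉ (ord.eraseIdx (pstar + 1)).set pstar (6, 6) := by
  intro hm
  obtain ⟨u, hu, hget⟩ := List.getElem_of_mem hm
  have hu20 : u < 20 := by rw [List.length_set, length_o20 h] at hu; exact hu
  by_cases hup : u = pstar
  · subst hup
    rw [List.getElem_set_self] at hget
    exact absurd (hget ▸ B_mem h) (by decide)
  · rw [List.getElem_set_ne (Ne.symm hup)] at hget
    exact B_not_mem_o20 h (hget ▸ List.getElem_mem _)

/-- Slot of `A` is `20`. [folklore] -/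
theorem slot_A (h : ordOK dl ord pstar = true) : (mkCtx dl ord pstar s br).slot (ord.getD pstar (0, 0)) = 20 := by
  unfold Ctx.slot
  rw [mkCtx_ordS, posOf_append_of_not_mem _ (A_not_mem_set h), List.length_set, length_o20 h, posOf_cons, if_pos rfl]

/-- Slot of `B` is `21`. [folklore] -/
theorem slot_B (h : ordOK dl ord pstar = true) : (mkCtx dl ord pstar s br).slot (ord.getD (pstar + 1) (0, 0)) = 21 := by
  unfold Ctx.slot
  rw [mkCtx_ordS, posOf_append_of_not_mem _ (B_not_mem_set h), List.length_set, length_o20 h, posOf_cons,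
    if_neg (A_ne_B h), posOf_cons, if_pos rfl]

/-- Trichotomy of atoms: `A`, `B`, or at a position `t ≠ p⋆` of the reduced order with slot `t`. [folklore] -/
theorem atom_cases (h : ordOK dl ord pstar = true) {a : Atom} (ha : a ∈ allAtoms) :
    a = ord.getD pstar (0, 0) ∨ a = ord.getD (pstar + 1) (0, 0) ∨
      ∃ t, ∃ ht : t < 20, t ≠ pstar ∧ (ord.eraseIdx (pstar + 1))[t]'(by rw [length_o20 h]; exact ht) = a := by
  rcases mem_o20_or_eq_B h ha with hm | hB
  · obtain ⟨t, ht, het⟩ := exists_pos_of_mem_o20 h hm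
    by_cases htp : t = pstar
    · left; subst htp; rw [← het, o20_getElem_pstar h]
    · right; right; exact ⟨t, ht, htp, het⟩
  · right; left; exact hB

/-- Every atom has a slot `< 22`. [folklore] -/
theorem slot_lt_22 (h : ordOK dl ord pstar = true) {a : Atom} (ha : a ∈ allAtoms) : (mkCtx dl ord pstar s br).slot a < 22 := by
  rcases atom_cases h ha with rfl | rfl | ⟨t, ht, htp, rfl⟩
  · rw [slot_A h]; norm_num
  · rw [slot_B h]; norm_num
  · rw [slot_of_o20 h ht htp]; omega

/-- The context of a checked support is well formed. [folklore] -/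
theorem mkCtx_wf (h : ordOK dl ord pstar = true) : (mkCtx dl ord pstar s br).WF :=
  ⟨fun a ha => slot_lt_22 h ha, by have := (ordOK_spec h).2.2.2.2.1; show pstar < 20; omega⟩

end Order

end Summit.ValiantsHypothesis.ValiantsHypothesis.Theorems.LacunarySymmetroidMatrixDescartes.Census.V19C
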